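import Mathlib
import Literature.Analysis.FluidPDE.ClassicalSolutionRescale
import Summits.NavierStokesRegularity.NavierStokesRegularity.Theorems.LandauTailLandauTailBlowupTypeIIFatou
import Summits.NavierStokesRegularity.NavierStokesRegularity.Theorems.LandauTailLandauTailBlowupReynoldsDefect

/-!
# Crux `LandauTail.LandauTailBlowup` (stmt-NavierStokesRegularity-1944), line `registered`, cycle c6:
  stub `landauTail_reynolds_defect_rescalings` — the Reynolds-stress defect identity for the blow-up rescalings

Lead file (c6). For a classical unit-viscosity solution `(u, p)` on `ℝ³ × (−1, 0)` with the parabolic (Landau) tail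
`√(−t) u(t, √(−t) y) → landauAxisField a A y` (`y ≠ 0`), every sequence `r n → 0⁺` in `(0, 1)` along which the
Navier–Stokes rescalings `u_{r_n} = nsRescale (r n) u` stay bounded in `L²(S)` about the jet `U = landauAxisField a A`,
and every solenoidal test `ψ` supported in `S = (s₁,s₂) × B_ρ ⊆ Q₁`:

  `∫∫ ⟪u_{r_n} − U, (∇ψ)(u_{r_n} − U)⟫ → 2π β(A) ∫ ⟪a, ψ(t, 0)⟫ dt`:

the Reynolds stress of the core's deviation from the Landau flow converges, solenoidal-distributionally, to LANDAU'S
POINT FORCE `β(A) a ⊗ δ_{axis}` — the route's momentum-flux bookkeeping ("a forceless core feeding a Landau far field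
must emit momentum at the constant rate b(U)") as a theorem about every witness, under pointwise convergence only.
Proof: the rescalings are classical solutions on `(−1, 0)` (`IsClassicalNSSolutionOn.nsRescale_holds`), hence satisfy
the very weak identity (`integral_veryWeak_eq_zero`); they converge pointwise off the axis to the jet
(`landauTail_nsRescale_tendsto_profile`); apply `landauTail_reynolds_defect_tendsto`.

References: Landau 1944; Lemarié-Rieusset 2016 (10.48); Chae 2007, proof of Thm 1.5 (p. 8); KNSS 2009 §4 (ii).
-/

set_option linter.dupNamespace false

noncomputable section

open MeasureTheory Set Function Filter Metric TopologicalSpace InnerProductSpace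
open scoped NNReal ENNReal Topology RealInnerProductSpace Laplacian ContDiff
open Literature.Analysis.FluidPDE

namespace Summit.NavierStokesRegularity.NavierStokesRegularity.Theorems

/-- **The Reynolds-stress defect identity for the blow-up rescalings** (registered support stub R2 of crux
stmt-NavierStokesRegularity-1944, lead c6): along `L²(S)`-bounded blow-up rescalings of a Landau-tailed classical
solution, `∫∫ ⟪u_{r_n} − U, (∇ψ)(u_{r_n} − U)⟫ → 2πβ(A) ∫ ⟪a, ψ(t,0)⟫ dt` for every solenoidal test `ψ` supported in
`S` (Landau 1944; Lemarié-Rieusset 2016 (10.48); Chae 2007 p. 8; KNSS 2009 §4 (ii)). -/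
theorem landauTail_reynolds_defect_rescalings : ∀ (u : ℝ → EuclideanSpace ℝ (Fin 3) → EuclideanSpace ℝ (Fin 3)) (p : ℝ → EuclideanSpace ℝ (Fin 3) → ℝ) (a : EuclideanSpace ℝ (Fin 3)) (A : ℝ) (ψ : ℝ → EuclideanSpace ℝ (Fin 3) → EuclideanSpace ℝ (Fin 3)) (s₁ s₂ ρ : ℝ) (C : NNReal) (r : ℕ → ℝ), ‖a‖ = 1 → 1 < A → -1 ≤ s₁ → s₁ < s₂ → s₂ ≤ 0 → 0 < ρ → ρ ≤ 1 → Literature.Analysis.FluidPDE.IsClassicalNSSolutionOn (Set.Ioo (-1) 0) 1 0 u p → (∀ y : EuclideanSpace ℝ (Fin 3), y ≠ 0 → Filter.Tendsto (fun t : ℝ => Real.sqrt (0 - t) • u t (Real.sqrt (0 - t) • y)) (nhdsWithin 0 (Set.Iio 0)) (nhds (Literature.Analysis.FluidPDE.landauAxisField a A y))) → Literature.Analysis.FluidPDE.IsSpaceTimeTestOn (Literature.Analysis.FluidPDE.parabolicCylinderOpens 1 ((0 : ℝ), (0 : EuclideanSpace ℝ (Fin 3)))) ψ → tsupport (Function.uncurry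 ψ) ⊆ Set.Ioo s₁ s₂ ×ˢ Metric.ball (0 : EuclideanSpace ℝ (Fin 3)) ρ → (∀ t x, Literature.Analysis.FluidPDE.VectorCalculus.divergence (ψ t) x = 0) → (∀ n, 0 < r n ∧ r n < 1) → Filter.Tendsto r Filter.atTop (nhds 0) → (∀ n, MeasureTheory.eLpNorm (fun z : ℝ × EuclideanSpace ℝ (Fin 3) => Literature.Analysis.FluidPDE.nsRescale (r n) u z.1 z.2 - Literature.Analysis.FluidPDE.landauAxisField a A z.2) 2 (MeasureTheory.volume.restrict (Set.Ioo s₁ s₂ ×ˢ Metric.ball (0 : EuclideanSpace ℝ (Fin 3)) ρ)) ≤ C) → Filter.Tendsto (fun n => ∫ t in Set.Ioo (-1 : ℝ) 0, ∫ x, inner ℝ (Literature.Analysis.FluidPDE.nsRescale (r n) u t x - Literature.Analysis.FluidPDE.landauAxisField a A x) ((fderiv ℝ (ψ t) x) (Literature.Analysis.FluidPDE.nsRescale (r n) u t x - Literature.Analysis.FluidPDE.landauAxisField a A x))) Filter.atTop (nhds ((2 * Real.pi * (8 * A / 3 * (3 * A ^ 2 + 1) / (A ^ 2 - 1) - 4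 * A ^ 2 * Real.log ((A + 1) / (A - 1)))) * ∫ t in Set.Ioo (-1 : ℝ) 0, inner ℝ a (ψ t 0))) := by
  intro u p a A ψ s₁ s₂ ρ C r ha hA hs₁ hs₁₂ hs₂ hρ hρ1 hcl htail hψ hS hdiv hr01 hr0 hbd
  set V : EuclideanSpace ℝ (Fin 3) → EuclideanSpace ℝ (Fin 3) := landauAxisField a A with hVdef
  obtain ⟨-, -, -, -, hhom, -⟩ := landauTail_landauAxisField_profile ha hA
  -- the rescalings are classical solutions on `(-1, 0)`
  set w : ℕ → ℝ → EuclideanSpace ℝ (Fin 3) → EuclideanSpace ℝ (Fin 3) := fun n => nsRescale (r n) u with hw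
  have hwcl : ∀ n, IsClassicalNSSolutionOn (Ioo (-1) 0) 1 0 (w n) (nsRescalePressure (r n) p) := by
    intro n
    obtain ⟨hrp, hr1⟩ := hr01 n
    have key := IsClassicalNSSolutionOn.nsRescale_holds hcl hrp
    rw [nsRescaleForce_zero] at key
    refine key.mono (fun t ht => ?_) (uniqueDiffOn_Ioo (-1) 0)
    simp only [mem_preimage, mem_Ioo] at ht ⊢
    have hr2 : (r n) ^ 2 ≤ 1 := pow_le_one₀ hrp.le hr1.le
    refine ⟨?_, mul_neg_of_pos_of_neg (pow_pos hrp 2) ht.2⟩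
    nlinarith [mul_nonneg (sub_nonneg.2 hr2) (neg_nonneg.2 ht.2.le)]
  have hwc : ∀ n, ContinuousOn (uncurry (w n)) (Ioo (-1 : ℝ) 0 ×ˢ univ) := fun n =>
    (hwcl n).smooth_velocity.continuousOn
  -- … hence satisfy the very weak identity against `ψ`
  have hψslab : IsSpaceTimeTestOn (slab (EuclideanSpace ℝ (Fin 3)) (Ioo (-1) 0) isOpen_Ioo) ψ :=
    hψ.mono fun z hz => by
      have hz' : z ∈ parabolicCylinder 1 ((0 : ℝ), (0 : EuclideanSpace ℝ (Fin 3))) := hz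
      rw [mem_parabolicCylinder] at hz'
      refine mem_slab.2 ⟨?_, hz'.1.2⟩
      have h1 := hz'.1.1
      norm_num at h1
      exact h1
  have hψdiv : ∀ t, VectorCalculus.IsDivFree (ψ t) := fun t x => hdiv t x
  have hid : ∀ n, ∫ t in Ioo (-1 : ℝ) 0, ∫ x, (⟪w n t x, timeDeriv ψ t x⟫ +
      ⟪w n t x, convect (w n t) (ψ t) x⟫ + 1 * ⟪w n t x, Δ (ψ t) x⟫) = 0 := fun n =>
    (hwcl n).integral_veryWeak_eq_zero hψslab hψdiv
  -- pointwise convergence off the axis, a.e. on `S`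
  have hr' : Tendsto r atTop (𝓝[>] (0 : ℝ)) :=
    tendsto_nhdsWithin_iff.2 ⟨hr0, Eventually.of_forall fun n => (hr01 n).1⟩
  set S : Set (ℝ × EuclideanSpace ℝ (Fin 3)) := Ioo s₁ s₂ ×ˢ ball (0 : EuclideanSpace ℝ (Fin 3)) ρ with hSdef
  have hSm : MeasurableSet S := measurableSet_Ioo.prod measurableSet_ball
  have hae0 : ∀ᵐ z ∂(volume : Measure (ℝ × EuclideanSpace ℝ (Fin 3))), z.2 ≠ 0 := by
    have e : {z : ℝ × EuclideanSpace ℝ (Fin 3) | z.2 = 0} = univ ×ˢ {0} := by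
      ext z
      simp
    rw [ae_iff]
    simp only [not_not]
    rw [e, Measure.volume_eq_prod, Measure.prod_prod, measure_singleton, mul_zero]
  have hae : ∀ᵐ z ∂(volume.restrict S), Tendsto (fun n => w n z.1 z.2) atTop (𝓝 (V z.2)) := by
    rw [ae_restrict_iff' hSm]
    filter_upwards [hae0] with z hz hzS
    have hz1 : z.1 < 0 := lt_of_lt_of_le hzS.1.2 hs₂
    exact (landauTail_nsRescale_tendsto_profile u V hhom htail z.1 hz1 z.2 hz).comp hr'
  exact landauTail_reynolds_defect_tendsto w a A ψ s₁ s₂ ρ C ha hA hs₁ hs₁₂ hs₂ hρ hρ1 hwc hψ hS hdiv hid hbd hae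

end Summit.NavierStokesRegularity.NavierStokesRegularity.Theorems

end
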